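import Mathlib.Analysis.Fourier.FourierTransform
import Mathlib.Analysis.SpecialFunctions.Gaussian.FourierTransform
import Mathlib.Analysis.SpecialFunctions.ImproperIntegrals
import Literature.NumberTheory.Sieve.SmoothZetaComplex
import HarnessLib

/-!
# A Gaussian-smoothed Perron formula for `Ψ(x, y)` (toward Hildebrand–Tenenbaum's Theorem 1 without Lemma 6)

Topic `Literature/NumberTheory/Sieve`; a PROVED tool file. Hildebrand–Tenenbaum [HildebrandTenenbaum1986, §4]
evaluate `Ψ(x, y) = (1/2πi) ∫_{α-iT}^{α+iT} ζ(s, y) x^s ds/s + Error` (their (2.14), Lemma 10) with the sharply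
truncated Perron kernel, which forces `T = exp((log y)^{3/2-ε})` and hence their Lemma 6 (Vinogradov's zero-free
region). Here the truncation is GAUSSIAN: with `h(w) = e^{αw} 1_{w ≤ 0}` (so that
`x^{-α} Ψ(x, y) = Σ_{n y-smooth} n^{-α} h(log n - log x)`) and the Gaussian density `k_T` of variance `1/T²`,

* `perronWeight_conv_eq_integral` — **the smoothed weight is a damped Fourier integral**:
  `(h ⋆ k_T)(w) = ∫_ℝ e^{-2π²ξ²/T²} e^{-2πiξw}/(α + 2πiξ) dξ` (Mathlib's self-adjointness
  `VectorFourier.integral_fourierIntegral_smul_eq_flip` of `𝓕`, the Gaussian `𝓕(e^{-2π²ξ²/T²}) = k_T` and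
  `𝓕(v ↦ h(w - v))(ξ) = e^{-2πiξw}/(α + 2πiξ)`);
* `abs_perronWeight_sub_conv_le` — **the smoothing error is Gaussian-localised at the jump**: for `0 < α ≤ T/2`,
  `|h(w) - e^{-α²/(2T²)} (h ⋆ k_T)(w)| ≤ 2 e^{-T²w²/8}` for all `w` (the factor `e^{-α²/(2T²)} = 1/∫ e^{-αv}k_T(v)dv`
  removes the smoothing of the continuous part EXACTLY; what is left is the Gaussian tail at the jump `w = 0`);
* `card_smooth_gaussPerron` — **the formula**: for `x ≥ 1`, `0 < α ≤ T/2`,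
  `|x^{-α} Ψ(x, y) - e^{-α²/(2T²)} Re ∫_ℝ e^{-2π²ξ²/T²} x^{2πiξ} ζ(α + 2πiξ, y)/(α + 2πiξ) dξ|
     ≤ 2 Σ_{n y-smooth} n^{-α} e^{-T²(log(n/x))²/8}`
  (`ζ(s, y) = Σ_{n y-smooth} n^{-s}`, tree `LSeriesHasSum_smoothIndicator`; the interchange of the sum over `n` and the
  `ξ`-integral is dominated by `ζ(α, y) e^{-2π²ξ²/T²}/α`).

The right side is a short-interval count of smooth numbers around `x` at the scale `1/T` (to be bounded by an
Esseen-type concentration inequality for the measure `n^{-α}/ζ(α, y)` on the smooth `n`); no information on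
`ζ(s, y)` off the line `Re s = α` and no lower bound on `T` beyond `T ≥ 2α` enter.

## References

* [HildebrandTenenbaum1986] A. Hildebrand, G. Tenenbaum, Trans. AMS 296 (1986) 265–290, §2 (2.14), §4 Lemmas 9–10
  (held: `paper:doi-10-1090-s0002-9947-1986-0837811-1`, pp. 271, 277–279).
* G. Tenenbaum, *Introduction to analytic and probabilistic number theory*, 3rd ed., AMS 2015, §II.2 (Perron
  formulae with smooth weights).

## Tree / Mathlib

Tree: `smoothZetaC`, `smoothIndicator`, `LSeriesHasSum_smoothIndicator`, `norm_smoothZetaC_le` (`SmoothZetaComplex`).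
Mathlib: `VectorFourier.integral_fourierIntegral_smul_eq_flip`, `Real.fourier_real_eq_integral_exp_smul`,
`fourier_gaussian_pi`, `integral_cexp_quadratic`, `integral_gaussian`, `integral_exp_mul_complex_Ioi`,
`MeasureTheory.integral_tsum_of_summable_integral_norm`, `MeasureTheory.integral_add_right_eq_self`.
-/

noncomputable section

open Complex MeasureTheory Real Set Filter
open scoped FourierTransform Topology

namespace Literature.NumberTheory.Sieve

namespace GaussPerron

variable {α T w v ξ : ℝ}

/-! ### The Gaussian kernel `k_T` and its weight `e^{-2π²ξ²/T²}` -/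

/-- The Gaussian probability density of variance `1/T²`: `k_T(v) = (T/√(2π)) e^{-T²v²/2}`. [folklore] -/
def perronGauss (T v : ℝ) : ℝ := T / Real.sqrt (2 * Real.pi) * Real.exp (-(T ^ 2 * v ^ 2 / 2))

/-- The Fourier weight `G_T(ξ) = e^{-2π²ξ²/T²}` (`𝓕 G_T = k_T`). [folklore] -/
def perronDamping (T ξ : ℝ) : ℂ := Complex.exp (-(2 * Real.pi ^ 2 / T ^ 2 * ξ ^ 2 : ℝ))

/-- `k_T > 0` (`T > 0`). [folklore] -/
theorem perronGauss_pos (hT : 0 < T) (v : ℝ) : 0 < perronGauss T v := by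
  unfold perronGauss; positivity

/-- `k_T ≥ 0` (`T > 0`). [folklore] -/
theorem perronGauss_nonneg (hT : 0 < T) (v : ℝ) : 0 ≤ perronGauss T v := (perronGauss_pos hT v).le

/-- `k_T` is continuous. [folklore] -/
theorem continuous_perronGauss (T : ℝ) : Continuous (perronGauss T) := by
  unfold perronGauss; fun_prop

/-- `|G_T(ξ)| = e^{-2π²ξ²/T²}`. [folklore] -/
theorem norm_perronDamping (T ξ : ℝ) : ‖perronDamping T ξ‖ = Real.exp (-(2 * Real.pi ^ 2 / T ^ 2 * ξ ^ 2)) := by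
  rw [perronDamping, ← Complex.ofReal_neg, Complex.norm_exp_ofReal]

/-- `|G_T(ξ)| ≤ 1`. [folklore] -/
theorem norm_perronDamping_le_one (T ξ : ℝ) : ‖perronDamping T ξ‖ ≤ 1 := by
  rw [norm_perronDamping, Real.exp_le_one_iff]
  have : 0 ≤ 2 * Real.pi ^ 2 / T ^ 2 * ξ ^ 2 := by positivity
  linarith

/-- `G_T` is continuous. [folklore] -/
theorem continuous_perronDamping (T : ℝ) : Continuous (perronDamping T) := by
  unfold perronDamping; fun_prop

/-- `G_T` is integrable (`T > 0`). [folklore] -/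
theorem integrable_perronDamping (hT : 0 < T) : Integrable (perronDamping T) := by
  have h := integrable_exp_neg_mul_sq (b := 2 * Real.pi ^ 2 / T ^ 2) (by positivity)
  have h2 : Integrable (fun ξ : ℝ => ((Real.exp (-(2 * Real.pi ^ 2 / T ^ 2) * ξ ^ 2) : ℝ) : ℂ)) := h.ofReal
  refine h2.congr (Eventually.of_forall fun ξ => ?_)
  simp only [perronDamping, Complex.ofReal_exp]
  congr 1; push_cast; ring

/-- **The moment generating function of `k_T`**: `∫ e^{λv} k_T(v) dv = e^{λ²/(2T²)}`. [folklore] -/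
theorem integral_exp_mul_perronGauss (hT : 0 < T) (lam : ℝ) :
    ∫ v : ℝ, Real.exp (lam * v) * perronGauss T v = Real.exp (lam ^ 2 / (2 * T ^ 2)) := by
  -- complete the square and use translation invariance + `integral_gaussian`
  have hc : ∀ v : ℝ, Real.exp (lam * v) * perronGauss T v =
      T / Real.sqrt (2 * Real.pi) * Real.exp (lam ^ 2 / (2 * T ^ 2)) *
        Real.exp (-(T ^ 2 / 2) * (v - lam / T ^ 2) ^ 2) := by
    intro v
    unfold perronGauss
    have hT2 : T ^ 2 ≠ 0 := by positivity
    rw [show lam * v = lam ^ 2 / (2 * T ^ 2) + (-(T ^ 2 / 2) * (v - lam / T ^ 2) ^ 2 + T ^ 2 * v ^ 2 / 2) by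
      field_simp; ring, Real.exp_add, Real.exp_add, Real.exp_neg (T ^ 2 * v ^ 2 / 2)]
    have := Real.exp_pos (T ^ 2 * v ^ 2 / 2)
    field_simp
  simp_rw [hc, MeasureTheory.integral_const_mul]
  rw [integral_sub_right_eq_self (fun v : ℝ => Real.exp (-(T ^ 2 / 2) * v ^ 2)) (lam / T ^ 2),
    integral_gaussian]
  have hπ : 0 < Real.pi := Real.pi_pos
  have h2 : Real.sqrt (Real.pi / (T ^ 2 / 2)) = Real.sqrt (2 * Real.pi) / T := by
    rw [show Real.pi / (T ^ 2 / 2) = 2 * Real.pi / T ^ 2 by field_simp, Real.sqrt_div (by positivity),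
      Real.sqrt_sq hT.le]
  rw [h2]
  have hs : 0 < Real.sqrt (2 * Real.pi) := Real.sqrt_pos.2 (by positivity)
  field_simp

/-- `∫ k_T = 1`. [folklore] -/
theorem integral_perronGauss (hT : 0 < T) : ∫ v : ℝ, perronGauss T v = 1 := by
  have h := integral_exp_mul_perronGauss hT 0
  simpa using h

/-- `v ↦ e^{λv} k_T(v)` is integrable. [folklore] -/
theorem integrable_exp_mul_perronGauss (hT : 0 < T) (lam : ℝ) :
    Integrable fun v : ℝ => Real.exp (lam * v) * perronGauss T v := by
  by_contra H
  have h := integral_exp_mul_perronGauss hT lam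
  rw [integral_undef H] at h
  exact (Real.exp_pos _).ne' h.symm

/-- `k_T` is integrable (`T > 0`). [folklore] -/
theorem integrable_perronGauss (hT : 0 < T) : Integrable (perronGauss T) := by
  simpa using integrable_exp_mul_perronGauss hT 0

/-- **Chernoff's bound for the Gaussian tail**: `∫_{v ≥ a} k_T(v) dv ≤ e^{-T²a²/2}` for `a ≥ 0`
(`1_{v ≥ a} ≤ e^{T²a(v - a)}` and the moment generating function). [folklore] -/
theorem integral_Ici_perronGauss_le (hT : 0 < T) {a : ℝ} (ha : 0 ≤ a) :
    ∫ v in Ici a, perronGauss T v ≤ Real.exp (-(T ^ 2 * a ^ 2 / 2)) := by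
  set lam : ℝ := T ^ 2 * a with hlam
  have hlam0 : 0 ≤ lam := by positivity
  have hint := integrable_exp_mul_perronGauss hT lam
  set F : ℝ → ℝ := fun v => Real.exp (lam * v) * perronGauss T v * Real.exp (-(lam * a)) with hF
  have hF_int : Integrable F := hint.mul_const _
  have hFeq : ∀ v : ℝ, F v = Real.exp (lam * (v - a)) * perronGauss T v := by
    intro v; simp only [hF]; rw [mul_sub, Real.exp_sub, Real.exp_neg]; field_simp
  have hF0 : ∀ v : ℝ, 0 ≤ F v := fun v => by
    simp only [hF]; have := perronGauss_nonneg hT v; positivity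
  calc ∫ v in Ici a, perronGauss T v ≤ ∫ v in Ici a, F v := by
        refine setIntegral_mono_on (integrable_perronGauss hT).integrableOn hF_int.integrableOn
          measurableSet_Ici fun v hv => ?_
        rw [hFeq]
        have h1 : 1 ≤ Real.exp (lam * (v - a)) :=
          Real.one_le_exp (mul_nonneg hlam0 (by linarith [show a ≤ v from hv]))
        nlinarith [perronGauss_nonneg hT v]
    _ ≤ ∫ v, F v := setIntegral_le_integral hF_int (Eventually.of_forall hF0)
    _ = Real.exp (-(lam * a)) * ∫ v, Real.exp (lam * v) * perronGauss T v := by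
        simp only [hF]; rw [integral_mul_const]; ring
    _ = Real.exp (-(T ^ 2 * a ^ 2 / 2)) := by
        rw [integral_exp_mul_perronGauss hT, ← Real.exp_add, hlam]
        congr 1; field_simp; ring

/-- The symmetric tail: `∫_{v ≤ -a} k_T(v) dv ≤ e^{-T²a²/2}` for `a ≥ 0` (`1_{v ≤ -a} ≤ e^{-T²a(v + a)}`).
[folklore] -/
theorem integral_Iic_perronGauss_le (hT : 0 < T) {a : ℝ} (ha : 0 ≤ a) :
    ∫ v in Iic (-a), perronGauss T v ≤ Real.exp (-(T ^ 2 * a ^ 2 / 2)) := by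
  set lam : ℝ := -(T ^ 2 * a) with hlam
  have hlam0 : lam ≤ 0 := by
    rw [hlam]
    have : 0 ≤ T ^ 2 * a := by positivity
    linarith
  have hint := integrable_exp_mul_perronGauss hT lam
  set F : ℝ → ℝ := fun v => Real.exp (lam * v) * perronGauss T v * Real.exp (lam * a) with hF
  have hF_int : Integrable F := hint.mul_const _
  have hFeq : ∀ v : ℝ, F v = Real.exp (lam * (v + a)) * perronGauss T v := by
    intro v; simp only [hF]; rw [mul_add, Real.exp_add]; ring
  have hF0 : ∀ v : ℝ, 0 ≤ F v := fun v => by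
    simp only [hF]; have := perronGauss_nonneg hT v; positivity
  calc ∫ v in Iic (-a), perronGauss T v ≤ ∫ v in Iic (-a), F v := by
        refine setIntegral_mono_on (integrable_perronGauss hT).integrableOn hF_int.integrableOn
          measurableSet_Iic fun v hv => ?_
        rw [hFeq]
        have hva : v + a ≤ 0 := by have : v ≤ -a := hv; linarith
        have h1 : 1 ≤ Real.exp (lam * (v + a)) := Real.one_le_exp (mul_nonneg_of_nonpos_of_nonpos hlam0 hva)
        nlinarith [perronGauss_nonneg hT v]
    _ ≤ ∫ v, F v := setIntegral_le_integral hF_int (Eventually.of_forall hF0)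
    _ = Real.exp (lam * a) * ∫ v, Real.exp (lam * v) * perronGauss T v := by
        simp only [hF]; rw [integral_mul_const]; ring
    _ = Real.exp (-(T ^ 2 * a ^ 2 / 2)) := by
        rw [integral_exp_mul_perronGauss hT, ← Real.exp_add, hlam]
        congr 1; field_simp; ring

/-! ### Fourier transforms: `𝓕 G_T = k_T` and `𝓕(v ↦ h(w - v))` -/

/-- **`𝓕(e^{-2π²ξ²/T²}) = k_T`**: the Fourier transform of the Gaussian weight is the Gaussian density of
variance `1/T²` (Mathlib's `fourier_gaussian_pi` with `b = 2π/T²`). [folklore] -/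
theorem fourier_perronDamping (hT : 0 < T) : 𝓕 (perronDamping T) = fun v : ℝ => ((perronGauss T v : ℝ) : ℂ) := by
  have hπ : 0 < Real.pi := Real.pi_pos
  set b : ℂ := ((2 * Real.pi / T ^ 2 : ℝ) : ℂ) with hb
  have hbre : 0 < b.re := by rw [hb, Complex.ofReal_re]; positivity
  have hfun : perronDamping T = fun x : ℝ => cexp (-Real.pi * b * x ^ 2) := by
    funext x
    rw [perronDamping, hb]
    congr 1
    have hT2 : (T : ℂ) ^ 2 ≠ 0 := by exact_mod_cast (pow_pos hT 2).ne'
    push_cast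
    field_simp
  rw [hfun, fourier_gaussian_pi hbre]
  funext t
  have hb12 : b ^ (1 / 2 : ℂ) = ((Real.sqrt (2 * Real.pi) / T : ℝ) : ℂ) := by
    rw [hb, show (1 / 2 : ℂ) = ((1 / 2 : ℝ) : ℂ) by push_cast; ring,
      ← Complex.ofReal_cpow (by positivity : (0 : ℝ) ≤ 2 * Real.pi / T ^ 2)]
    congr 1
    rw [← Real.sqrt_eq_rpow, Real.sqrt_div (by positivity), Real.sqrt_sq hT.le]
  have hexp : cexp (-Real.pi / b * (t : ℂ) ^ 2) = ((Real.exp (-(T ^ 2 * t ^ 2 / 2)) : ℝ) : ℂ) := by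
    rw [Complex.ofReal_exp]
    congr 1
    rw [hb]
    have hT2 : (T : ℂ) ≠ 0 := by exact_mod_cast hT.ne'
    have hπ0 : (Real.pi : ℂ) ≠ 0 := by exact_mod_cast hπ.ne'
    push_cast
    field_simp
  rw [hb12, hexp, perronGauss]
  have hs : Real.sqrt (2 * Real.pi) ≠ 0 := (Real.sqrt_pos.2 (by positivity)).ne'
  have hsC : ((Real.sqrt (2 * Real.pi) : ℝ) : ℂ) ≠ 0 := by exact_mod_cast hs
  have hTC : (T : ℂ) ≠ 0 := by exact_mod_cast hT.ne'
  push_cast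
  field_simp

/-- The one-sided exponential `h(w) = e^{αw} 1_{w ≤ 0}` (so that `x^{-α} 1_{n ≤ x} = n^{-α} h(log n - log x)`). [folklore] -/
def perronWeight (α w : ℝ) : ℝ := if w ≤ 0 then Real.exp (α * w) else 0

/-- `h(w) = e^{αw}` for `w ≤ 0`. [folklore] -/
theorem perronWeight_of_nonpos (α : ℝ) (hw : w ≤ 0) : perronWeight α w = Real.exp (α * w) := if_pos hw

/-- `h(w) = 0` for `w > 0`. [folklore] -/
theorem perronWeight_of_pos (α : ℝ) (hw : 0 < w) : perronWeight α w = 0 := if_neg (not_le.2 hw)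

/-- `h ≥ 0`. [folklore] -/
theorem perronWeight_nonneg (α w : ℝ) : 0 ≤ perronWeight α w := by
  unfold perronWeight; split_ifs <;> positivity

/-- `h ≤ 1` (`α ≥ 0`). [folklore] -/
theorem perronWeight_le_one (hα : 0 ≤ α) (w : ℝ) : perronWeight α w ≤ 1 := by
  unfold perronWeight
  split_ifs with h
  · exact Real.exp_le_one_iff.2 (mul_nonpos_of_nonneg_of_nonpos hα h)
  · exact zero_le_one

/-- `v ↦ h(w - v)` is `e^{α(w - v)}` on `[w, ∞)` and `0` elsewhere. [folklore] -/
theorem perronWeight_sub_eq_indicator (α w v : ℝ) :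
    perronWeight α (w - v) = (Ici w).indicator (fun v => Real.exp (α * (w - v))) v := by
  unfold perronWeight
  by_cases h : w ≤ v
  · rw [if_pos (by linarith), indicator_of_mem (mem_Ici.2 h)]
  · rw [if_neg (by linarith), indicator_of_notMem (by simpa using h)]

/-- `h` is measurable. [folklore] -/
theorem measurable_perronWeight (α : ℝ) : Measurable (perronWeight α) := by
  unfold perronWeight
  refine Measurable.ite measurableSet_Iic (by fun_prop) measurable_const

/-- `v ↦ h(w - v)` is integrable (`α > 0`). [folklore] -/
theorem integrable_perronWeight_sub (hα : 0 < α) (w : ℝ) :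
    Integrable fun v : ℝ => perronWeight α (w - v) := by
  have h : IntegrableOn (fun v : ℝ => Real.exp (α * (w - v))) (Ici w) := by
    have h1 : IntegrableOn (fun v : ℝ => Real.exp (α * w) * Real.exp (-α * v)) (Ioi w) :=
      (exp_neg_integrableOn_Ioi w hα).const_mul (Real.exp (α * w))
    rw [integrableOn_Ici_iff_integrableOn_Ioi]
    refine h1.congr_fun (fun v _ => ?_) measurableSet_Ioi
    show Real.exp (α * w) * Real.exp (-α * v) = Real.exp (α * (w - v))
    rw [← Real.exp_add]; congr 1; ring
  have := h.integrable_indicator measurableSet_Ici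
  refine this.congr (Eventually.of_forall fun v => ?_)
  exact (perronWeight_sub_eq_indicator α w v).symm

/-- `v ↦ h(w - v)` is integrable as a complex function (`α > 0`). [folklore] -/
theorem integrable_perronWeight_sub_ofReal (hα : 0 < α) (w : ℝ) :
    Integrable fun v : ℝ => ((perronWeight α (w - v) : ℝ) : ℂ) :=
  (integrable_perronWeight_sub hα w).ofReal

/-- **`𝓕(v ↦ h(w - v))(ξ) = e^{-2πiξw}/(α + 2πiξ)`** (`∫_w^∞ e^{α(w-v)} e^{-2πivξ} dv`). [folklore] -/
theorem fourier_perronWeight_sub (hα : 0 < α) (w ξ : ℝ) :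
    𝓕 (fun v : ℝ => ((perronWeight α (w - v) : ℝ) : ℂ)) ξ =
      cexp (-(2 * Real.pi * ξ * w : ℝ) * I) / ((α : ℂ) + 2 * Real.pi * ξ * I) := by
  rw [Real.fourier_real_eq_integral_exp_smul]
  set a : ℂ := -((α : ℂ) + 2 * Real.pi * ξ * I) with ha
  have hare : a.re < 0 := by simp [ha, hα]
  have ha0 : a ≠ 0 := fun h => by rw [h] at hare; simp at hare
  -- the integrand is the indicator of `[w, ∞)` of `e^{αw} e^{a v}`
  have hint : (fun v : ℝ => cexp (↑(-2 * Real.pi * v * ξ) * I) • (((perronWeight α (w - v)) : ℝ) : ℂ)) =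
      (Ici w).indicator (fun v : ℝ => cexp ((α * w : ℝ) : ℂ) * cexp (a * v)) := by
    funext v
    rw [perronWeight_sub_eq_indicator]
    by_cases hv : v ∈ Ici w
    · rw [indicator_of_mem hv, indicator_of_mem hv, smul_eq_mul, Complex.ofReal_exp, ← Complex.exp_add,
        ← Complex.exp_add]
      congr 1
      rw [ha]; push_cast; ring
    · rw [indicator_of_notMem hv, indicator_of_notMem hv]; simp
  rw [hint, integral_indicator measurableSet_Ici, integral_Ici_eq_integral_Ioi, integral_const_mul,
    integral_exp_mul_complex_Ioi hare w]
  -- `e^{αw} · (-e^{aw}/a) = e^{-2πiξw}/(α + 2πiξ)`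
  have hexp : cexp ((α * w : ℝ) : ℂ) * cexp (a * w) = cexp (-(2 * Real.pi * ξ * w : ℝ) * I) := by
    rw [← Complex.exp_add]; congr 1; rw [ha]; push_cast; ring
  rw [mul_div_assoc', mul_neg, hexp, neg_div, ha, div_neg, neg_neg]

/-! ### The smoothed weight as a damped Fourier integral -/

/-- **`(h ⋆ k_T)(w) = ∫_ℝ e^{-2π²ξ²/T²} e^{-2πiξw}/(α + 2πiξ) dξ`** (`α, T > 0`): the self-adjointness of `𝓕`
applied to `v ↦ h(w - v)` and the Gaussian weight, whose transform is `k_T`.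
[cite: HildebrandTenenbaum1986, §4 (proof of Lemma 9: "the bilateral Laplace transform")] -/
theorem perronWeight_conv_eq_integral (hα : 0 < α) (hT : 0 < T) (w : ℝ) :
    (((∫ v : ℝ, perronWeight α (w - v) * perronGauss T v : ℝ)) : ℂ) =
      ∫ ξ : ℝ, perronDamping T ξ * (cexp (-(2 * Real.pi * ξ * w : ℝ) * I) / ((α : ℂ) + 2 * Real.pi * ξ * I)) := by
  have hf := integrable_perronWeight_sub_ofReal hα w
  have hg := integrable_perronDamping hT
  have key : ∫ ξ : ℝ, 𝓕 (fun v : ℝ => ((perronWeight α (w - v) : ℝ) : ℂ)) ξ * perronDamping T ξ =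
      ∫ v : ℝ, (((perronWeight α (w - v) : ℝ)) : ℂ) * 𝓕 (perronDamping T) v := by
    have key := VectorFourier.integral_fourierIntegral_smul_eq_flip (L := innerₗ ℝ) (μ := volume)
      (ν := volume) Real.continuous_fourierChar continuous_inner hf hg
    have hflip : (innerₗ ℝ).flip = innerₗ ℝ := by ext; simp
    rw [hflip] at key
    simp only [smul_eq_mul] at key
    exact key
  rw [fourier_perronDamping hT] at key
  simp_rw [fourier_perronWeight_sub hα] at key
  have hcoe : (((∫ v : ℝ, perronWeight α (w - v) * perronGauss T v : ℝ)) : ℂ) =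
      ∫ v : ℝ, (((perronWeight α (w - v) : ℝ)) : ℂ) * ((perronGauss T v : ℝ) : ℂ) := by
    rw [← integral_complex_ofReal]
    refine integral_congr_ae (Eventually.of_forall fun v => ?_)
    push_cast; rfl
  rw [hcoe, ← key]
  refine integral_congr_ae (Eventually.of_forall fun ξ => ?_)
  exact mul_comm _ _

/-! ### The smoothing error at the jump -/

/-- `(h ⋆ k_T)(w) = e^{αw} ∫_{v ≥ w} e^{-αv} k_T(v) dv`. [folklore] -/
theorem perronWeight_conv_eq (α T w : ℝ) :
    ∫ v : ℝ, perronWeight α (w - v) * perronGauss T v =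
      Real.exp (α * w) * ∫ v in Ici w, Real.exp (-α * v) * perronGauss T v := by
  rw [← integral_const_mul, ← integral_indicator measurableSet_Ici]
  refine integral_congr_ae (Eventually.of_forall fun v => ?_)
  show perronWeight α (w - v) * perronGauss T v = (Ici w).indicator (fun a => Real.exp (α * w) *
    (Real.exp (-α * a) * perronGauss T a)) v
  rw [perronWeight_sub_eq_indicator]
  by_cases hv : v ∈ Ici w
  · rw [indicator_of_mem hv, indicator_of_mem hv, ← mul_assoc, ← Real.exp_add]
    congr 2; ring
  · rw [indicator_of_notMem hv, indicator_of_notMem hv, zero_mul]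

/-- Completing the square: `e^{-αv} k_T(v) = e^{α²/(2T²)} k_T(v + α/T²)`. [folklore] -/
theorem exp_neg_mul_perronGauss (hT : 0 < T) (α v : ℝ) :
    Real.exp (-α * v) * perronGauss T v = Real.exp (α ^ 2 / (2 * T ^ 2)) * perronGauss T (v + α / T ^ 2) := by
  unfold perronGauss
  have hT2 : T ^ 2 ≠ 0 := by positivity
  have h : -α * v + -(T ^ 2 * v ^ 2 / 2) = α ^ 2 / (2 * T ^ 2) + -(T ^ 2 * (v + α / T ^ 2) ^ 2 / 2) := by
    field_simp; ring
  calc Real.exp (-α * v) * (T / Real.sqrt (2 * Real.pi) * Real.exp (-(T ^ 2 * v ^ 2 / 2)))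
      = T / Real.sqrt (2 * Real.pi) * Real.exp (-α * v + -(T ^ 2 * v ^ 2 / 2)) := by rw [Real.exp_add]; ring
    _ = T / Real.sqrt (2 * Real.pi) * Real.exp (α ^ 2 / (2 * T ^ 2) + -(T ^ 2 * (v + α / T ^ 2) ^ 2 / 2)) := by
        rw [h]
    _ = _ := by rw [Real.exp_add]; ring

/-- Translating a set integral of `k_T`: `∫_{v < w} k_T(v + c) dv = ∫_{s < w + c} k_T(s) ds`. [folklore] -/
theorem setIntegral_Iio_perronGauss_add (T w c : ℝ) :
    ∫ v in Iio w, perronGauss T (v + c) = ∫ s in Iio (w + c), perronGauss T s := by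
  rw [← integral_indicator measurableSet_Iio, ← integral_indicator measurableSet_Iio,
    ← integral_add_right_eq_self (fun s => (Iio (w + c)).indicator (perronGauss T) s) c]
  refine integral_congr_ae (Eventually.of_forall fun v => ?_)
  show (Iio w).indicator (fun v => perronGauss T (v + c)) v = (Iio (w + c)).indicator (perronGauss T) (v + c)
  by_cases hv : v ∈ Iio w
  · have hv' : v + c ∈ Iio (w + c) := by simp only [mem_Iio] at hv ⊢; linarith
    rw [indicator_of_mem hv, indicator_of_mem hv']
  · have hv' : v + c ∉ Iio (w + c) := by simp only [mem_Iio, not_lt] at hv ⊢; linarith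
    rw [indicator_of_notMem hv, indicator_of_notMem hv']

/-- `∫_{v ≥ w} k_T(v + c) dv = ∫_{s ≥ w + c} k_T(s) ds`. [folklore] -/
theorem setIntegral_Ici_perronGauss_add (T w c : ℝ) :
    ∫ v in Ici w, perronGauss T (v + c) = ∫ s in Ici (w + c), perronGauss T s := by
  rw [← integral_indicator measurableSet_Ici, ← integral_indicator measurableSet_Ici,
    ← integral_add_right_eq_self (fun s => (Ici (w + c)).indicator (perronGauss T) s) c]
  refine integral_congr_ae (Eventually.of_forall fun v => ?_)
  show (Ici w).indicator (fun v => perronGauss T (v + c)) v = (Ici (w + c)).indicator (perronGauss T) (v + c)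
  by_cases hv : v ∈ Ici w
  · have hv' : v + c ∈ Ici (w + c) := by simp only [mem_Ici] at hv ⊢; linarith
    rw [indicator_of_mem hv, indicator_of_mem hv']
  · have hv' : v + c ∉ Ici (w + c) := by simp only [mem_Ici, not_le] at hv ⊢; linarith
    rw [indicator_of_notMem hv, indicator_of_notMem hv']

/-- `e^{1/8} ≤ 2`. [folklore] -/
theorem exp_one_div_eight_le_two : Real.exp (1 / 8) ≤ 2 := by
  have h := Real.exp_bound (x := (1 / 8 : ℝ)) (by norm_num) (n := 2) (by norm_num)
  simp only [Finset.sum_range_succ, Finset.sum_range_zero] at h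
  norm_num [Nat.factorial] at h
  rw [abs_le] at h
  linarith [h.2]

set_option maxHeartbeats 400000 in
/-- **The smoothing error is Gaussian-localised at the jump.** For `0 < α ≤ T/2` and every `w`:
`|h(w) - e^{-α²/(2T²)} (h ⋆ k_T)(w)| ≤ 2 e^{-T²w²/8}`. With `K = ∫ e^{-αv} k_T = e^{α²/(2T²)}` and
`e^{-αv} k_T(v) = K k_T(v + α/T²)`: for `w ≤ 0` the error is `e^{αw} ∫_{s < w + α/T²} k_T ≥ 0`, at most the
Gaussian tail `e^{-T²w²/8}` when `T|w| ≥ 1` (`w + α/T² ≤ w/2`) and at most `1 ≤ 2e^{-T²w²/8}` otherwise; for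
`w > 0` it is `-e^{αw} ∫_{s ≥ w + α/T²} k_T`, of size `≤ e^{αw} e^{-T²(w + α/T²)²/2} ≤ e^{-T²w²/2}`.
[cite: HildebrandTenenbaum1986, §4 Lemma 9 (Gaussian smoothing of Ψ)] -/
theorem abs_perronWeight_sub_conv_le (hα : 0 < α) (hT : 0 < T) (hαT : α ≤ T / 2) (w : ℝ) :
    |perronWeight α w - Real.exp (-(α ^ 2 / (2 * T ^ 2))) * ∫ v : ℝ, perronWeight α (w - v) * perronGauss T v| ≤
      2 * Real.exp (-(T ^ 2 * w ^ 2 / 8)) := by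
  set K : ℝ := Real.exp (α ^ 2 / (2 * T ^ 2)) with hK
  have hK0 : 0 < K := Real.exp_pos _
  set c : ℝ := α / T ^ 2 with hc
  have hc0 : 0 < c := by positivity
  have hcT : c ≤ 1 / (2 * T) := by
    rw [hc, div_le_div_iff₀ (by positivity) (by positivity)]; nlinarith
  set E : ℝ → ℝ := fun v => Real.exp (-α * v) * perronGauss T v with hE
  have hEint : Integrable E := integrable_exp_mul_perronGauss hT (-α)
  have hEeq : ∀ v, E v = K * perronGauss T (v + c) := fun v => exp_neg_mul_perronGauss hT α v
  have hkint := integrable_perronGauss hT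
  have hk1 := integral_perronGauss hT
  -- the convolution in terms of `E`
  have hconv : ∫ v : ℝ, perronWeight α (w - v) * perronGauss T v = Real.exp (α * w) * ∫ v in Ici w, E v :=
    perronWeight_conv_eq α T w
  -- `∫_{Ici w} E = K ∫_{Ici (w + c)} k`
  have hIci : ∫ v in Ici w, E v = K * ∫ s in Ici (w + c), perronGauss T s := by
    rw [← setIntegral_Ici_perronGauss_add T w c, ← integral_const_mul]
    exact setIntegral_congr_fun measurableSet_Ici fun v _ => hEeq v
  -- nonnegativity of set integrals of `k`
  have hk0 : ∀ s, 0 ≤ perronGauss T s := perronGauss_nonneg hT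
  have hkset_le_one : ∀ S : Set ℝ, ∫ s in S, perronGauss T s ≤ 1 := fun S => by
    rw [← hk1]; exact setIntegral_le_integral hkint (Eventually.of_forall hk0)
  have hkset_nonneg : ∀ S : Set ℝ, 0 ≤ ∫ s in S, perronGauss T s := fun S =>
    integral_nonneg fun s => hk0 s
  -- `2 e^{-T²w²/8} ≥` the relevant Gaussian quantities
  have hgoal_ge_one_of_small : T * |w| < 1 → 1 ≤ 2 * Real.exp (-(T ^ 2 * w ^ 2 / 8)) := by
    intro hsmall
    have h1 : T ^ 2 * w ^ 2 < 1 := by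
      have : (T * |w|) ^ 2 < 1 := by nlinarith [abs_nonneg w, mul_nonneg hT.le (abs_nonneg w)]
      rw [mul_pow, sq_abs] at this; exact this
    have h2 : Real.exp (-(1 / 8)) ≤ Real.exp (-(T ^ 2 * w ^ 2 / 8)) := Real.exp_le_exp.2 (by linarith)
    have h3 : 1 ≤ 2 * Real.exp (-(1 / 8 : ℝ)) := by
      rw [Real.exp_neg, ← div_eq_mul_inv, le_div_iff₀ (Real.exp_pos _)]
      linarith [exp_one_div_eight_le_two]
    linarith
  rcases le_or_gt w 0 with hw | hw
  · -- ### `w ≤ 0`: the error is `e^{αw} ∫_{Iio (w + c)} k ≥ 0`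
    have hR : perronWeight α w - Real.exp (-(α ^ 2 / (2 * T ^ 2))) *
        ∫ v : ℝ, perronWeight α (w - v) * perronGauss T v =
        Real.exp (α * w) * ∫ s in Iio (w + c), perronGauss T s := by
      rw [perronWeight_of_nonpos α hw, hconv, hIci]
      have hKinv : Real.exp (-(α ^ 2 / (2 * T ^ 2))) = K⁻¹ := by rw [hK, Real.exp_neg]
      rw [hKinv]
      have h2 : ∫ s in Iio (w + c), perronGauss T s = 1 - ∫ s in Ici (w + c), perronGauss T s := by
        have h := integral_add_compl (μ := volume) (measurableSet_Ici : MeasurableSet (Ici (w + c))) hkint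
        rw [compl_Ici, hk1] at h
        linarith
      rw [h2]
      field_simp
    rw [hR]
    have hexpw : Real.exp (α * w) ≤ 1 := Real.exp_le_one_iff.2 (mul_nonpos_of_nonneg_of_nonpos hα.le hw)
    have hexpw0 : 0 < Real.exp (α * w) := Real.exp_pos _
    have hI0 := hkset_nonneg (Iio (w + c))
    rw [abs_of_nonneg (mul_nonneg hexpw0.le hI0)]
    rcases lt_or_ge (T * |w|) 1 with hsmall | hbig
    · calc Real.exp (α * w) * ∫ s in Iio (w + c), perronGauss T s ≤ 1 * 1 :=
            mul_le_mul hexpw (hkset_le_one _) hI0 zero_le_one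
        _ = 1 := one_mul 1
        _ ≤ _ := hgoal_ge_one_of_small hsmall
    · -- `w + c ≤ w/2 = -(|w|/2)`
      have hwabs : |w| = -w := abs_of_nonpos hw
      have hwc : w + c ≤ -(|w| / 2) := by
        rw [hwabs]
        have h1 : 1 ≤ T * (-w) := by rwa [hwabs] at hbig
        have h2 : c ≤ 1 / (2 * T) := hcT
        have h3 : 1 / (2 * T) ≤ -w / 2 := by
          rw [div_le_div_iff₀ (by positivity) (by norm_num)]; nlinarith
        linarith
      calc Real.exp (α * w) * ∫ s in Iio (w + c), perronGauss T s
          ≤ 1 * ∫ s in Iic (-(|w| / 2)), perronGauss T s := by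
            refine mul_le_mul hexpw ?_ hI0 zero_le_one
            exact setIntegral_mono_set hkint.integrableOn (Eventually.of_forall hk0)
              (Eventually.of_forall fun s hs => le_trans (le_of_lt hs) hwc)
        _ ≤ Real.exp (-(T ^ 2 * (|w| / 2) ^ 2 / 2)) := by
            rw [one_mul]; exact integral_Iic_perronGauss_le hT (by positivity)
        _ = Real.exp (-(T ^ 2 * w ^ 2 / 8)) := by rw [div_pow, sq_abs]; ring_nf
        _ ≤ 2 * Real.exp (-(T ^ 2 * w ^ 2 / 8)) := by linarith [Real.exp_pos (-(T ^ 2 * w ^ 2 / 8))]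
  · -- ### `w > 0`: the error is `-e^{αw} ∫_{Ici (w + c)} k`
    have hR : perronWeight α w - Real.exp (-(α ^ 2 / (2 * T ^ 2))) *
        ∫ v : ℝ, perronWeight α (w - v) * perronGauss T v =
        -(Real.exp (α * w) * ∫ s in Ici (w + c), perronGauss T s) := by
      rw [perronWeight_of_pos α hw, hconv, hIci]
      have hKinv : Real.exp (-(α ^ 2 / (2 * T ^ 2))) = K⁻¹ := by rw [hK, Real.exp_neg]
      rw [hKinv]
      field_simp
      ring
    rw [hR, abs_neg]
    have hexpw0 : 0 < Real.exp (α * w) := Real.exp_pos _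
    have hI0 := hkset_nonneg (Ici (w + c))
    rw [abs_of_nonneg (mul_nonneg hexpw0.le hI0)]
    have hwc0 : 0 ≤ w + c := by linarith
    calc Real.exp (α * w) * ∫ s in Ici (w + c), perronGauss T s
        ≤ Real.exp (α * w) * Real.exp (-(T ^ 2 * (w + c) ^ 2 / 2)) :=
          mul_le_mul_of_nonneg_left (integral_Ici_perronGauss_le hT hwc0) hexpw0.le
      _ ≤ Real.exp (-(T ^ 2 * w ^ 2 / 8)) := by
          rw [← Real.exp_add]
          refine Real.exp_le_exp.2 ?_
          -- `αw - T²(w+c)²/2 ≤ -T²w²/8`: `T²(w+c)² ≥ T²w² + 2T²wc = T²w² + 2αw`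
          have h1 : T ^ 2 * (w + c) ^ 2 / 2 ≥ T ^ 2 * w ^ 2 / 2 + α * w := by
            have hTc : T ^ 2 * c = α := by rw [hc]; field_simp
            nlinarith [sq_nonneg c, mul_pos hT hT, hw, hc0]
          nlinarith [sq_nonneg w, mul_pos hT hT]
      _ ≤ 2 * Real.exp (-(T ^ 2 * w ^ 2 / 8)) := by linarith [Real.exp_pos (-(T ^ 2 * w ^ 2 / 8))]

/-! ### Summation over the `y`-smooth numbers -/

variable {x : ℝ} {y n : ℕ}

/-- The weights `n^{-α}` on the `y`-smooth numbers are summable (`α > 0`): `Σ = ζ(α, y)`. [folklore] -/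
theorem hasSum_indicator_rpow_neg (hα : 0 < α) (y : ℕ) :
    HasSum (fun n : ℕ => (Nat.smoothNumbers (y + 1)).indicator (fun n : ℕ => (n : ℝ) ^ (-α)) n)
      (smoothZeta α y) := by
  have h := LSeriesHasSum_smoothIndicator (s := (α : ℂ)) (by simpa using hα) y
  rw [LSeriesHasSum, show LSeries.term (smoothIndicator y) (α : ℂ) =
    (Nat.smoothNumbers (y + 1)).indicator (fun m : ℕ => (m : ℂ) ^ (-(α : ℂ))) from
      funext (term_smoothIndicator y α), smoothZetaC_ofReal] at h
  have h2 : ((Nat.smoothNumbers (y + 1)).indicator (fun m : ℕ => (m : ℂ) ^ (-(α : ℂ)))) =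
      fun n : ℕ => (((Nat.smoothNumbers (y + 1)).indicator (fun n : ℕ => (n : ℝ) ^ (-α)) n : ℝ) : ℂ) := by
    funext n
    by_cases hn : n ∈ Nat.smoothNumbers (y + 1)
    · rw [indicator_of_mem hn, indicator_of_mem hn, show (n : ℂ) = ((n : ℝ) : ℂ) by norm_cast,
        ← Complex.ofReal_neg, ← Complex.ofReal_cpow (Nat.cast_nonneg n)]
    · rw [indicator_of_notMem hn, indicator_of_notMem hn, Complex.ofReal_zero]
  rw [h2] at h
  exact Complex.hasSum_ofReal.1 h

/-- A dominated real sequence on the smooth numbers is summable: if `|g n| ≤ B n^{-α}` on the `y`-smooth `n`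
then `Σ_{n y-smooth} g(n)` converges. [folklore] -/
theorem summable_indicator_of_le (hα : 0 < α) {g : ℕ → ℝ} {B : ℝ}
    (hg : ∀ n ∈ Nat.smoothNumbers (y + 1), |g n| ≤ B * (n : ℝ) ^ (-α)) :
    Summable fun n : ℕ => (Nat.smoothNumbers (y + 1)).indicator g n := by
  refine Summable.of_norm_bounded ((hasSum_indicator_rpow_neg hα y).summable.mul_left B) fun n => ?_
  by_cases hn : n ∈ Nat.smoothNumbers (y + 1)
  · rw [indicator_of_mem hn, indicator_of_mem hn, Real.norm_eq_abs]; exact hg n hn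
  · rw [indicator_of_notMem hn, indicator_of_notMem hn]; simp

/-- **`x^{-α} Ψ(x, y) = Σ_{n y-smooth} n^{-α} h(log n - log x)`** (`x ≥ 1`): the sum is finite, over the smooth
`n ≤ x`, each contributing `n^{-α} (n/x)^α = x^{-α}`. [folklore] -/
theorem hasSum_indicator_perronWeight (hx : 1 ≤ x) (α : ℝ) (y : ℕ) :
    HasSum (fun n : ℕ => (Nat.smoothNumbers (y + 1)).indicator
        (fun n : ℕ => (n : ℝ) ^ (-α) * perronWeight α (Real.log n - Real.log x)) n)
      (x ^ (-α) * ((Nat.smoothNumbersUpTo ⌊x⌋₊ (y + 1)).card : ℝ)) := by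
  have hx0 : 0 < x := by linarith
  set S := Nat.smoothNumbersUpTo ⌊x⌋₊ (y + 1) with hS
  -- the terms vanish off `S` and equal `x^{-α}` on `S`
  have hval : ∀ n : ℕ, (Nat.smoothNumbers (y + 1)).indicator
      (fun n : ℕ => (n : ℝ) ^ (-α) * perronWeight α (Real.log n - Real.log x)) n =
        if n ∈ S then x ^ (-α) else 0 := by
    intro n
    by_cases hn : n ∈ Nat.smoothNumbers (y + 1)
    · rw [indicator_of_mem hn]
      have hn0 : 0 < n := Nat.pos_of_ne_zero (Nat.ne_zero_of_mem_smoothNumbers hn)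
      have hn0r : (0 : ℝ) < n := by exact_mod_cast hn0
      by_cases hnx : (n : ℝ) ≤ x
      · have hmem : n ∈ S := Nat.mem_smoothNumbersUpTo.2 ⟨Nat.le_floor hnx, hn⟩
        rw [if_pos hmem, perronWeight_of_nonpos α (by linarith [Real.log_le_log hn0r hnx]),
          Real.rpow_def_of_pos hn0r, Real.rpow_def_of_pos hx0, ← Real.exp_add]
        congr 1; ring
      · push Not at hnx
        have hmem : n ∉ S := fun h => by
          have h1 := (Nat.mem_smoothNumbersUpTo.1 h).1
          have : (n : ℝ) ≤ x := le_trans (by exact_mod_cast h1) (Nat.floor_le hx0.le)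
          linarith
        rw [if_neg hmem, perronWeight_of_pos α (by linarith [Real.log_lt_log hx0 hnx]), mul_zero]
    · rw [indicator_of_notMem hn, if_neg (fun h => hn (Nat.mem_smoothNumbersUpTo.1 h).2)]
  simp_rw [hval]
  have h : HasSum (fun n : ℕ => if n ∈ S then x ^ (-α) else (0 : ℝ))
      (∑ n ∈ S, if n ∈ S then x ^ (-α) else (0 : ℝ)) :=
    hasSum_sum_of_ne_finset_zero (fun n hn => if_neg hn)
  rw [Finset.sum_ite_mem, Finset.inter_self, Finset.sum_const, nsmul_eq_mul, mul_comm] at h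
  exact h

/-- `x^{iτ} n^{-(α + iτ)} = n^{-α} e^{-iτ(log n - log x)}` for real `x, n > 0` (any complex `τ`). [folklore] -/
theorem cpow_mul_natCast_cpow_neg (hx : 0 < x) (hn : 0 < n) (α : ℝ) (τ : ℂ) :
    (x : ℂ) ^ (τ * I) * (n : ℂ) ^ (-((α : ℂ) + τ * I)) =
      (((n : ℝ) ^ (-α) : ℝ) : ℂ) * cexp (-(τ * ((Real.log n : ℂ) - (Real.log x : ℂ)) * I)) := by
  have hn0 : (0 : ℝ) < n := by exact_mod_cast hn
  have hxC : (x : ℂ) ≠ 0 := by exact_mod_cast hx.ne'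
  have hnC : (n : ℂ) ≠ 0 := by exact_mod_cast hn.ne'
  rw [Complex.cpow_def_of_ne_zero hxC, Complex.cpow_def_of_ne_zero hnC,
    show (n : ℂ) = ((n : ℝ) : ℂ) by simp, (Complex.ofReal_log hn0.le).symm, (Complex.ofReal_log hx.le).symm,
    Real.rpow_def_of_pos hn0, Complex.ofReal_exp, ← Complex.exp_add, ← Complex.exp_add]
  congr 1
  push_cast
  ring

/-- **The smoothed sum is the damped Fourier integral of `ζ(s, y) x^s/s` on `Re s = α`**:
`Σ_{n y-smooth} n^{-α} (h ⋆ k_T)(log n - log x) = ∫_ℝ e^{-2π²ξ²/T²} x^{2πiξ} ζ(α + 2πiξ, y)/(α + 2πiξ) dξ`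
(`α, T > 0`, `x > 0`; the `n`-sum and the `ξ`-integral are interchanged by dominated convergence, the `n`-th term
having `ξ`-integral of norms `n^{-α} ∫ e^{-2π²ξ²/T²}/|α + 2πiξ| dξ`). [cite: HildebrandTenenbaum1986, §2 (2.14) and §4] -/
theorem hasSum_indicator_conv (hα : 0 < α) (hT : 0 < T) (hx : 0 < x) (y : ℕ) :
    HasSum (fun n : ℕ => (((Nat.smoothNumbers (y + 1)).indicator
        (fun n : ℕ => (n : ℝ) ^ (-α) * ∫ v : ℝ, perronWeight α (Real.log n - Real.log x - v) * perronGauss T v) n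
          : ℝ) : ℂ))
      (∫ ξ : ℝ, perronDamping T ξ * ((x : ℂ) ^ (2 * Real.pi * ξ * I) *
        smoothZetaC ((α : ℂ) + 2 * Real.pi * ξ * I) y / ((α : ℂ) + 2 * Real.pi * ξ * I))) := by
  -- the summands as `ξ`-integrals
  set F : ℕ → ℝ → ℂ := fun n ξ => (Nat.smoothNumbers (y + 1)).indicator (fun n : ℕ =>
    (((n : ℝ) ^ (-α) : ℝ) : ℂ) * (perronDamping T ξ * (cexp (-((2 * Real.pi * ξ * (Real.log n - Real.log x) : ℝ) : ℂ) * I) /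
      ((α : ℂ) + 2 * Real.pi * ξ * I)))) n with hF
  have hden : ∀ ξ : ℝ, (α : ℂ) + 2 * Real.pi * ξ * I ≠ 0 := fun ξ h => by
    have := congrArg Complex.re h; simp at this; linarith
  have hden_norm : ∀ ξ : ℝ, α ≤ ‖(α : ℂ) + 2 * Real.pi * ξ * I‖ := fun ξ => by
    have h := Complex.abs_re_le_norm ((α : ℂ) + 2 * Real.pi * ξ * I)
    simp [abs_of_pos hα] at h
    exact h
  -- the dominating function `ξ ↦ ‖G_T(ξ)‖/‖α + 2πiξ‖`
  set D : ℝ → ℝ := fun ξ => ‖perronDamping T ξ‖ / ‖(α : ℂ) + 2 * Real.pi * ξ * I‖ with hD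
  have hDcont : Continuous D :=
    (continuous_perronDamping T).norm.div (Continuous.norm (by fun_prop)) fun ξ => (norm_pos_iff.2 (hden ξ)).ne'
  have hDint : Integrable D := by
    refine ((integrable_perronDamping hT).norm.div_const α).mono' hDcont.aestronglyMeasurable
      (Eventually.of_forall fun ξ => ?_)
    rw [hD, Real.norm_eq_abs, abs_of_nonneg (by positivity)]
    exact div_le_div_of_nonneg_left (norm_nonneg _) hα (hden_norm ξ)
  -- each `F n` is integrable, with `‖F n ξ‖ = 1_S(n) n^{-α} D(ξ)`
  have hFnorm : ∀ n : ℕ, ∀ ξ : ℝ, ‖F n ξ‖ =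
      (Nat.smoothNumbers (y + 1)).indicator (fun n : ℕ => (n : ℝ) ^ (-α)) n * D ξ := by
    intro n ξ
    simp only [hF, hD]
    by_cases hn : n ∈ Nat.smoothNumbers (y + 1)
    · rw [indicator_of_mem hn, indicator_of_mem hn, norm_mul, norm_mul, norm_div, Complex.norm_real,
        Real.norm_eq_abs, abs_of_nonneg (Real.rpow_nonneg (Nat.cast_nonneg n) _), ← Complex.ofReal_neg,
        Complex.norm_exp_ofReal_mul_I]
      ring
    · rw [indicator_of_notMem hn, indicator_of_notMem hn, norm_zero, zero_mul]
  have hFmeas : ∀ n : ℕ, AEStronglyMeasurable (F n) := by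
    intro n
    simp only [hF]
    by_cases hn : n ∈ Nat.smoothNumbers (y + 1)
    · simp only [indicator_of_mem hn]
      refine Continuous.aestronglyMeasurable ?_
      exact continuous_const.mul ((continuous_perronDamping T).mul (Continuous.div (by fun_prop) (by fun_prop) hden))
    · simp only [indicator_of_notMem hn]
      exact aestronglyMeasurable_const
  have hFint : ∀ n : ℕ, Integrable (F n) := fun n =>
    (hDint.const_mul ((Nat.smoothNumbers (y + 1)).indicator (fun n : ℕ => (n : ℝ) ^ (-α)) n)).mono' (hFmeas n)
      (Eventually.of_forall fun ξ => (hFnorm n ξ).le)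
  have hsum : Summable fun n : ℕ => ∫ ξ : ℝ, ‖F n ξ‖ := by
    have : (fun n : ℕ => ∫ ξ : ℝ, ‖F n ξ‖) =
        fun n : ℕ => (Nat.smoothNumbers (y + 1)).indicator (fun n : ℕ => (n : ℝ) ^ (-α)) n * ∫ ξ : ℝ, D ξ := by
      funext n; simp_rw [hFnorm n]; exact integral_const_mul _ _
    rw [this]
    exact (hasSum_indicator_rpow_neg hα y).summable.mul_right _
  have hmain := hasSum_integral_of_summable_integral_norm hFint hsum
  -- the `n`-th integral is `n^{-α} (h ⋆ k_T)(log n - log x)`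
  have hleft : (fun n : ℕ => ∫ ξ : ℝ, F n ξ) = fun n : ℕ => (((Nat.smoothNumbers (y + 1)).indicator
      (fun n : ℕ => (n : ℝ) ^ (-α) * ∫ v : ℝ, perronWeight α (Real.log n - Real.log x - v) * perronGauss T v) n
        : ℝ) : ℂ) := by
    funext n
    simp only [hF]
    by_cases hn : n ∈ Nat.smoothNumbers (y + 1)
    · simp only [indicator_of_mem hn]
      rw [integral_const_mul, ← perronWeight_conv_eq_integral hα hT (Real.log n - Real.log x)]
      push_cast
      rfl
    · simp only [indicator_of_notMem hn, integral_zero, Complex.ofReal_zero]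
  -- the sum under the integral is `G_T(ξ) x^{2πiξ} ζ(α + 2πiξ, y)/(α + 2πiξ)`
  have hpt : ∀ ξ : ℝ, HasSum (fun n : ℕ => F n ξ) (perronDamping T ξ * ((x : ℂ) ^ (2 * Real.pi * ξ * I) *
      smoothZetaC ((α : ℂ) + 2 * Real.pi * ξ * I) y / ((α : ℂ) + 2 * Real.pi * ξ * I))) := by
    intro ξ
    have hsre : 0 < ((α : ℂ) + 2 * Real.pi * ξ * I).re := by simp [hα]
    have hL := LSeriesHasSum_smoothIndicator hsre y
    rw [LSeriesHasSum, show LSeries.term (smoothIndicator y) ((α : ℂ) + 2 * Real.pi * ξ * I) =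
      (Nat.smoothNumbers (y + 1)).indicator (fun m : ℕ => (m : ℂ) ^ (-((α : ℂ) + 2 * Real.pi * ξ * I))) from
        funext (term_smoothIndicator y _)] at hL
    have hL2 := hL.mul_left (perronDamping T ξ * (x : ℂ) ^ (2 * Real.pi * ξ * I) / ((α : ℂ) + 2 * Real.pi * ξ * I))
    have hfun : (fun n : ℕ => F n ξ) = fun n : ℕ =>
        perronDamping T ξ * (x : ℂ) ^ (2 * Real.pi * ξ * I) / ((α : ℂ) + 2 * Real.pi * ξ * I) *
          (Nat.smoothNumbers (y + 1)).indicator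
            (fun m : ℕ => (m : ℂ) ^ (-((α : ℂ) + 2 * Real.pi * ξ * I))) n := by
      funext n
      simp only [hF]
      by_cases hn : n ∈ Nat.smoothNumbers (y + 1)
      · rw [indicator_of_mem hn, indicator_of_mem hn]
        have hn0 : 0 < n := Nat.pos_of_ne_zero (Nat.ne_zero_of_mem_smoothNumbers hn)
        have key := cpow_mul_natCast_cpow_neg hx hn0 α (2 * Real.pi * ξ)
        have hexp : cexp (-((2 * Real.pi * ξ * (Real.log n - Real.log x) : ℝ) : ℂ) * I) =
            cexp (-((2 * Real.pi * ξ : ℂ) * ((Real.log n : ℂ) - (Real.log x : ℂ)) * I)) := by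
          congr 1; push_cast; ring
        rw [hexp, show perronDamping T ξ * (x : ℂ) ^ (2 * Real.pi * ξ * I) / ((α : ℂ) + 2 * Real.pi * ξ * I) *
            (n : ℂ) ^ (-((α : ℂ) + 2 * Real.pi * ξ * I)) =
          perronDamping T ξ / ((α : ℂ) + 2 * Real.pi * ξ * I) *
            ((x : ℂ) ^ ((2 * Real.pi * ξ : ℂ) * I) * (n : ℂ) ^ (-((α : ℂ) + (2 * Real.pi * ξ : ℂ) * I))) by ring, key]
        ring
      · rw [indicator_of_notMem hn, indicator_of_notMem hn, mul_zero]
    rw [hfun, show perronDamping T ξ * ((x : ℂ) ^ (2 * Real.pi * ξ * I) *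
        smoothZetaC ((α : ℂ) + 2 * Real.pi * ξ * I) y / ((α : ℂ) + 2 * Real.pi * ξ * I)) =
      perronDamping T ξ * (x : ℂ) ^ (2 * Real.pi * ξ * I) / ((α : ℂ) + 2 * Real.pi * ξ * I) *
        smoothZetaC ((α : ℂ) + 2 * Real.pi * ξ * I) y by ring]
    exact hL2
  have hright : ∫ ξ : ℝ, ∑' n : ℕ, F n ξ = ∫ ξ : ℝ, perronDamping T ξ * ((x : ℂ) ^ (2 * Real.pi * ξ * I) *
      smoothZetaC ((α : ℂ) + 2 * Real.pi * ξ * I) y / ((α : ℂ) + 2 * Real.pi * ξ * I)) :=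
    integral_congr_ae (Eventually.of_forall fun ξ => (hpt ξ).tsum_eq)
  rw [hleft, hright] at hmain
  exact hmain

/-- **Gaussian-smoothed Perron formula for `Ψ(x, y)`.** For `x ≥ 1`, `α > 0`, `T ≥ 2α` and every `y`,
`|x^{-α} Ψ(x, y) - e^{-α²/(2T²)} Re ∫_ℝ e^{-2π²ξ²/T²} x^{2πiξ} ζ(α + 2πiξ, y)/(α + 2πiξ) dξ|
  ≤ 2 Σ_{n y-smooth} n^{-α} e^{-T²(log n - log x)²/8}`:
Perron's formula for the counting function of the smooth numbers with the sharp cut-off `1_{n ≤ x}` replaced by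
its Gaussian regularisation at scale `1/T` in `log n`, the price being paid only by the smooth `n` with
`|log(n/x)| ≲ 1/T` (HT use the sharp truncation `(2.14)` at height `T` and, in Lemma 9, the same Gaussian damping
`exp(T⁻² (s - α)²)` to localise; here the two are combined so that no bound for `ζ(s, y)` at height `> T` is ever
needed). [cite: HildebrandTenenbaum1986, §2 (2.14) and §4, Lemma 9 (proof)] -/
theorem card_smooth_gaussPerron (hx : 1 ≤ x) (hα : 0 < α) (hT : 0 < T) (hαT : α ≤ T / 2) (y : ℕ) :
    |x ^ (-α) * ((Nat.smoothNumbersUpTo ⌊x⌋₊ (y + 1)).card : ℝ) -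
        Real.exp (-(α ^ 2 / (2 * T ^ 2))) * (∫ ξ : ℝ, perronDamping T ξ * ((x : ℂ) ^ (2 * Real.pi * ξ * I) *
          smoothZetaC ((α : ℂ) + 2 * Real.pi * ξ * I) y / ((α : ℂ) + 2 * Real.pi * ξ * I))).re| ≤
      2 * ∑' n : ℕ, (Nat.smoothNumbers (y + 1)).indicator
        (fun n : ℕ => (n : ℝ) ^ (-α) * Real.exp (-(T ^ 2 * (Real.log n - Real.log x) ^ 2 / 8))) n := by
  have hx0 : 0 < x := by linarith
  set S := Nat.smoothNumbers (y + 1) with hS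
  -- the three series
  set a : ℕ → ℝ := fun n => S.indicator (fun n : ℕ => (n : ℝ) ^ (-α) * perronWeight α (Real.log n - Real.log x)) n
    with ha
  set b : ℕ → ℝ := fun n => S.indicator (fun n : ℕ => (n : ℝ) ^ (-α) *
    ∫ v : ℝ, perronWeight α (Real.log n - Real.log x - v) * perronGauss T v) n with hb
  set e : ℕ → ℝ := fun n => S.indicator
    (fun n : ℕ => (n : ℝ) ^ (-α) * Real.exp (-(T ^ 2 * (Real.log n - Real.log x) ^ 2 / 8))) n with he
  have hA : HasSum a (x ^ (-α) * ((Nat.smoothNumbersUpTo ⌊x⌋₊ (y + 1)).card : ℝ)) :=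
    hasSum_indicator_perronWeight hx α y
  have hBc := hasSum_indicator_conv hα hT hx0 y
  have hB : HasSum b (∫ ξ : ℝ, perronDamping T ξ * ((x : ℂ) ^ (2 * Real.pi * ξ * I) *
      smoothZetaC ((α : ℂ) + 2 * Real.pi * ξ * I) y / ((α : ℂ) + 2 * Real.pi * ξ * I))).re := by
    have := Complex.hasSum_re hBc
    simpa using this
  have hE : Summable e := by
    refine summable_indicator_of_le (B := 1) hα fun n hn => ?_
    rw [abs_of_nonneg (by positivity), one_mul]
    refine mul_le_of_le_one_right (by positivity) (Real.exp_le_one_iff.2 ?_)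
    have : 0 ≤ T ^ 2 * (Real.log n - Real.log x) ^ 2 / 8 := by positivity
    linarith
  -- termwise comparison
  have hterm : ∀ n : ℕ, |a n - Real.exp (-(α ^ 2 / (2 * T ^ 2))) * b n| ≤ 2 * e n := by
    intro n
    by_cases hn : n ∈ S
    · simp only [ha, hb, he, indicator_of_mem hn]
      have hn0 : (0 : ℝ) ≤ (n : ℝ) ^ (-α) := Real.rpow_nonneg (Nat.cast_nonneg n) _
      have h := abs_perronWeight_sub_conv_le hα hT hαT (Real.log n - Real.log x)
      rw [show (n : ℝ) ^ (-α) * perronWeight α (Real.log n - Real.log x) -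
          Real.exp (-(α ^ 2 / (2 * T ^ 2))) * ((n : ℝ) ^ (-α) *
            ∫ v : ℝ, perronWeight α (Real.log n - Real.log x - v) * perronGauss T v) =
          (n : ℝ) ^ (-α) * (perronWeight α (Real.log n - Real.log x) - Real.exp (-(α ^ 2 / (2 * T ^ 2))) *
            ∫ v : ℝ, perronWeight α (Real.log n - Real.log x - v) * perronGauss T v) by ring,
        abs_mul, abs_of_nonneg hn0]
      nlinarith
    · simp only [ha, hb, he, indicator_of_notMem hn]; simp
  -- sum up
  have hdiff : HasSum (fun n => a n - Real.exp (-(α ^ 2 / (2 * T ^ 2))) * b n)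
      (x ^ (-α) * ((Nat.smoothNumbersUpTo ⌊x⌋₊ (y + 1)).card : ℝ) -
        Real.exp (-(α ^ 2 / (2 * T ^ 2))) * (∫ ξ : ℝ, perronDamping T ξ * ((x : ℂ) ^ (2 * Real.pi * ξ * I) *
          smoothZetaC ((α : ℂ) + 2 * Real.pi * ξ * I) y / ((α : ℂ) + 2 * Real.pi * ξ * I))).re) :=
    hA.sub (hB.mul_left _)
  rw [← hdiff.tsum_eq, ← tsum_mul_left]
  have hE2 : Summable fun n => 2 * e n := hE.mul_left 2
  have habs : Summable fun n => |a n - Real.exp (-(α ^ 2 / (2 * T ^ 2))) * b n| :=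
    Summable.of_nonneg_of_le (fun n => abs_nonneg _) hterm hE2
  calc |∑' n, (a n - Real.exp (-(α ^ 2 / (2 * T ^ 2))) * b n)|
      ≤ ∑' n, |a n - Real.exp (-(α ^ 2 / (2 * T ^ 2))) * b n| := by
        rw [← Real.norm_eq_abs]
        exact norm_tsum_le_tsum_norm (by simpa [Real.norm_eq_abs] using habs)
    _ ≤ ∑' n, 2 * e n := habs.tsum_le_tsum hterm hE2

end GaussPerron

end Literature.NumberTheory.Sieve
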